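import Summits.KontsevichZagierPeriods.KontsevichZagierPeriods.Theorems.SoloInformedBakerLogIndep
import Summits.KontsevichZagierPeriods.KontsevichZagierPeriods.Theorems.SoloInformedKZPOneKCharts
import HarnessLib
import HarnessLib.Audit

/-!
# SoloInformed — the Baker ring: the period conjecture on the subring of `P` generated by one-variable rational integrals, from algebraic independence of logarithms

Solo programme `solo-KontsevichZagierPeriods-informed`, session s119, file 2 (of 2).

The **Baker group** `soloInformedBakerGroup ⊆ P = FormalPeriodRing` is the image in `P` of the span
of points `[pt, a]` and segments `Seg(g, c)` (`soloInformedSegSpan`, file 7 of s112); it contains the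
class of every absolutely convergent rational integral of dimension `≤ 1` (`ℚ`- or `K`-rational,
`K = ℚ̄ ∩ ℝ`; files 9/18 of s112) and of every dimension-`0` representation, and the restriction of
`evalP` to it is injective UNCONDITIONALLY (`soloInformed_bakerGroup_eq_of_evalP_eq` — the kernel
property of the span, Baker's theorem). The **Baker ring** `soloInformedBakerRing` is the subring of
`P` it generates: all products `[D₁ × ⋯ × D_k, ∏ Nᵢ(xᵢ)/Mᵢ(xᵢ)]` of such integrals and their
`ℤ`-combinations — formal periods of every weight.

Main theorem (`soloInformed_eq_zero_of_mem_bakerRing`): **assuming the conjecture on algebraic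
independence of logarithms of algebraic numbers** (`Literature.Barriers.Schanuel.AlgIndepLogarithms`;
a consequence of Schanuel's conjecture), `evalP` is injective on the Baker ring — i.e. the
Kontsevich–Zagier period conjecture (`KontsevichZagierPeriods ↔ Function.Injective evalP`) holds for
all pairs of elements of the Baker ring (`soloInformed_injOn_evalP_bakerRing`,
`soloInformed_sub_mem_relations_of_mem_bakerRing`, `soloInformed_equivalent_prod_of_isRational`).

Proof.  (i) Scalars: `⟦[pt, κ]⟧ · ⟦x⟧ = ⟦scale κ x⟧` (`soloInformed_pt_mul_toFormalPeriod`, from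
`[pt, κ] · [τ, g] = relabelled [τ, κ g]`), so the Baker group is a `K`-submodule of `P` and
`κ ↦ ⟦[pt, κ]⟧` is a ring morphism `soloInformedPtHom : K →+* P` into it.  (ii) An element `x` of
the Baker ring is `q(t₁, …, t_n)` with `q ∈ ℤ[X]` and `tᵢ` in the group (`Subring.closure ≤
Algebra.adjoin ℤ`).  (iii) Choose a `K`-basis `{1} ∪ {e_l}` of the `K`-span of `1, evalP t₁, …`
inside that set (`exists_linearIndepOn_id_extension`); by group injectivity
`tᵢ = ρ(κᵢ₀) + Σ_l ρ(κᵢₗ) u_l` in `P`, where `evalP u_l = e_l`.  (iv) Hence `x = P₁(u)` and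
`evalP x = P₁(e)` for one polynomial `P₁ ∈ K[Y_l]` (`MvPolynomial.ringHom_ext`).  (v) The `e_l` are
Baker values, `K`-linearly independent together with `1`, so by file 1
(`soloInformed_algebraicIndependent_of_algIndepLogarithms`) they are algebraically independent over
`K` under the conjecture: `evalP x = 0` forces `P₁ = 0`, hence `x = 0`.

Placement.  Unconditionally the tree has `KZPUpTo 1` and the weight-`2` faces `C4EW (2,3)`,
`NoPairCert` (each EQUIVALENT to an open four-exponentials-type statement); here the whole Baker ring
— every weight — follows from ONE classical transcendence conjecture (the full conjecture additionally
needs `π`-cancellation, `soloInformed_kzp_iff_piLocalKernel_and_piCancellation`).  The converse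
("conjecture on the Baker ring ⇒ `AlgIndepLogarithms`") needs motivic input and is not claimed.

References: A. Baker, *Transcendental Number Theory* (1975), Ch. 2; M. Waldschmidt (2000),
Conj. 1.15; M. Kontsevich, D. Zagier, *Periods* (2001), §1.2, §4.1.
-/

noncomputable section

open scoped BigOperators

namespace Summit.KontsevichZagierPeriods.KontsevichZagierPeriods.Theorems

open Set
open Literature.NumberTheory.Transcendental Literature.NumberTheory.Transcendental.KZ
open Literature.Barriers.Schanuel (AlgIndepLogarithms)

/-! ### The Baker group and the Baker ring -/

/-- **The Baker group**: the image in `P` of the span of points and segments — the classes of all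
`ℤ`-combinations of `[pt, a]`, `Seg(g, c)` and relations. [this work] -/
def soloInformedBakerGroup : AddSubgroup FormalPeriodRing where
  carrier := {t | ∃ x ∈ soloInformedSegSpan, toFormalPeriod x = t}
  zero_mem' := ⟨0, zero_mem _, map_zero _⟩
  add_mem' := by
    rintro _ _ ⟨x, hx, rfl⟩ ⟨y, hy, rfl⟩
    exact ⟨x + y, add_mem hx hy, map_add _ _ _⟩
  neg_mem' := by
    rintro _ ⟨x, hx, rfl⟩
    exact ⟨-x, neg_mem hx, map_neg _ _⟩

/-- **The Baker ring**: the subring of the formal period ring generated by the Baker group.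
[this work] -/
def soloInformedBakerRing : Subring FormalPeriodRing :=
  Subring.closure (soloInformedBakerGroup : Set FormalPeriodRing)

/-- Classes of elements of the span lie in the Baker group. -/
theorem soloInformed_toFormalPeriod_mem_bakerGroup {x : FormalRep} (hx : x ∈ soloInformedSegSpan) :
    toFormalPeriod x ∈ soloInformedBakerGroup := ⟨x, hx, rfl⟩

/-- The Baker group is contained in the Baker ring. -/
theorem soloInformed_bakerGroup_le_bakerRing {t : FormalPeriodRing}
    (ht : t ∈ soloInformedBakerGroup) : t ∈ soloInformedBakerRing := Subring.subset_closure ht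

/-- **Unconditional injectivity on the Baker group** (the kernel property of the span = Baker's
theorem): two elements of the Baker group with the same value are equal in `P`.
[Baker 1975, Thm. 2.1; this work] -/
theorem soloInformed_bakerGroup_eq_of_evalP_eq {t t' : FormalPeriodRing}
    (ht : t ∈ soloInformedBakerGroup) (ht' : t' ∈ soloInformedBakerGroup)
    (h : evalP t = evalP t') : t = t' := by
  obtain ⟨x, hx, rfl⟩ := ht
  obtain ⟨y, hy, rfl⟩ := ht'
  rw [toFormalPeriod_eq_iff]
  refine soloInformed_mem_relations_of_mem_segSpan (sub_mem hx hy) ?_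
  rw [evalP_toFormalPeriod, evalP_toFormalPeriod] at h
  rw [map_sub, h, sub_self]

/-- **Values of the Baker group are Baker values** (normal form of the span). [this work] -/
theorem soloInformed_evalP_mem_bakerValues {t : FormalPeriodRing}
    (ht : t ∈ soloInformedBakerGroup) : evalP t ∈ soloInformedBakerValues := by
  obtain ⟨x, hx, rfl⟩ := ht
  obtain ⟨a, ha, A, g, c, hadm, hrel⟩ := soloInformed_segNF_of_mem_segSpan hx
  have hker := relations_le_ker_eval_holds hrel
  rw [AddMonoidHom.mem_ker, map_sub, sub_eq_zero, soloInformed_eval_ptRep_add_sum ha hadm] at hker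
  exact ⟨a, ha, A, g, c, fun k => hadm k, hker⟩

/-- `⟦[pt, κ]⟧` lies in the Baker group. -/
theorem soloInformed_pt_mem_bakerGroup (κ : ℝ) (hκ : IsAlgebraic ℚ κ) :
    toFormalPeriod (of (soloInformedPtRep κ hκ)) ∈ soloInformedBakerGroup :=
  ⟨_, soloInformed_ptRep_mem_segSpan κ hκ, rfl⟩

/-- `evalP ⟦[pt, κ]⟧ = κ`. -/
@[simp] theorem soloInformed_evalP_pt (κ : ℝ) (hκ : IsAlgebraic ℚ κ) :
    evalP (toFormalPeriod (of (soloInformedPtRep κ hκ))) = κ := by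
  rw [evalP_toFormalPeriod_of, soloInformed_value_ptRep]

/-- `1 ∈` Baker group (`1 = ⟦[pt, 1]⟧`, a dimension-`0` representation). -/
theorem soloInformed_one_mem_bakerGroup : (1 : FormalPeriodRing) ∈ soloInformedBakerGroup :=
  ⟨of IntegralRep.unit, soloInformed_segSpan_of_dim_zero _, toFormalPeriod_of_unit⟩

/-! ### Scalars: `⟦[pt, κ]⟧ · ⟦x⟧ = ⟦scale κ x⟧` -/

/-- `[pt, κ] · [τ, g]` IS the relabelled `[τ, κ g]` (equality of representations along
`Fin m ≃ Fin (0 + m)`; cf. `IntegralRep.unit_prod_eq_reindex`). [folklore] -/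
theorem soloInformed_ptRep_prod_eq_reindex {m : ℕ} (κ : ℝ) (hκ : IsAlgebraic ℚ κ)
    (s : IntegralRep m) :
    (soloInformedPtRep κ hκ).prod s =
      (s.constMul κ hκ).reindex (finCongr (Nat.zero_add m).symm) := by
  have hcoord : ∀ (w : Fin (0 + m) → ℝ),
      (fun j => w (Fin.natAdd 0 j)) = fun i => w (finCongr (Nat.zero_add m).symm i) := by
    intro w; funext j; simp
  refine IntegralRep.ext' ?_ ?_
  · ext w
    simp only [IntegralRep.prod_domain, IntegralRep.mem_prodDomain, soloInformed_ptRep_domain,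
      mem_univ, true_and, IntegralRep.reindex_domain, IntegralRep.domain_constMul, mem_setOf_eq,
      hcoord]
  · rw [IntegralRep.prod_integrand_eq, IntegralRep.reindex_integrand]
    funext w
    rw [IntegralRep.prodFun_apply, soloInformed_ptRep_integrand, IntegralRep.integrand_constMul,
      hcoord]

/-- **`⟦[pt, κ]⟧ · ⟦x⟧ = ⟦scale κ x⟧`**: multiplication by the class of a point is scaling of the
integrands. [this work] -/
theorem soloInformed_pt_mul_toFormalPeriod {κ : ℝ} (hκ : IsAlgebraic ℚ κ) (x : FormalRep) :
    toFormalPeriod (of (soloInformedPtRep κ hκ)) * toFormalPeriod x =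
      toFormalPeriod (scale κ hκ x) := by
  induction x using FreeAbelianGroup.induction_on with
  | zero => simp
  | of X =>
    obtain ⟨m, s⟩ := X
    show toFormalPeriod (of (soloInformedPtRep κ hκ)) * toFormalPeriod (of s) =
      toFormalPeriod (scale κ hκ (of s))
    rw [toFormalPeriod_of_mul_of, scale_of, soloInformed_ptRep_prod_eq_reindex,
      toFormalPeriod_eq_iff]
    have h := relations.neg_mem
      (of_sub_of_reindex_mem_relations (s.constMul κ hκ) (finCongr (Nat.zero_add m).symm))
    rwa [neg_sub] at h
  | neg X ih => rw [map_neg, mul_neg, ih, map_neg, map_neg]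
  | add X Y hX hY => rw [map_add, mul_add, hX, hY, map_add, map_add]

/-- The Baker group is stable under multiplication by `⟦[pt, κ]⟧` (it is a `K`-submodule of `P`). -/
theorem soloInformed_pt_mul_mem_bakerGroup {κ : ℝ} (hκ : IsAlgebraic ℚ κ) {t : FormalPeriodRing}
    (ht : t ∈ soloInformedBakerGroup) :
    toFormalPeriod (of (soloInformedPtRep κ hκ)) * t ∈ soloInformedBakerGroup := by
  obtain ⟨x, hx, rfl⟩ := ht
  rw [soloInformed_pt_mul_toFormalPeriod]
  exact ⟨_, soloInformed_scale_mem_segSpan hκ hx, rfl⟩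

/-- **The scalar morphism `ρ : K →+* P`, `κ ↦ ⟦[pt, κ]⟧`** (`K` the real algebraic numbers); its
ring axioms hold by injectivity on the Baker group. [this work] -/
def soloInformedPtHom : (algebraicClosure ℚ ℝ) →+* FormalPeriodRing where
  toFun k := toFormalPeriod (of (soloInformedPtRep (k : ℝ) (mem_algebraicClosure_iff.1 k.2)))
  map_one' := soloInformed_bakerGroup_eq_of_evalP_eq (soloInformed_pt_mem_bakerGroup _ _)
    soloInformed_one_mem_bakerGroup (by simp)
  map_mul' x y := soloInformed_bakerGroup_eq_of_evalP_eq (soloInformed_pt_mem_bakerGroup _ _)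
    (soloInformed_pt_mul_mem_bakerGroup _ (soloInformed_pt_mem_bakerGroup _ _)) (by simp)
  map_zero' := soloInformed_bakerGroup_eq_of_evalP_eq (soloInformed_pt_mem_bakerGroup _ _)
    (zero_mem _) (by simp)
  map_add' x y := soloInformed_bakerGroup_eq_of_evalP_eq (soloInformed_pt_mem_bakerGroup _ _)
    (add_mem (soloInformed_pt_mem_bakerGroup _ _) (soloInformed_pt_mem_bakerGroup _ _)) (by simp)

/-- Unfolding `ρ`. -/
theorem soloInformed_ptHom_apply (k : algebraicClosure ℚ ℝ) :
    soloInformedPtHom k =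
      toFormalPeriod (of (soloInformedPtRep (k : ℝ) (mem_algebraicClosure_iff.1 k.2))) := rfl

/-- `evalP (ρ κ) = κ`. -/
@[simp] theorem soloInformed_evalP_ptHom (k : algebraicClosure ℚ ℝ) :
    evalP (soloInformedPtHom k) = (k : ℝ) := by
  rw [soloInformed_ptHom_apply, soloInformed_evalP_pt]

/-- `ρ κ` lies in the Baker group. -/
theorem soloInformed_ptHom_mem_bakerGroup (k : algebraicClosure ℚ ℝ) :
    soloInformedPtHom k ∈ soloInformedBakerGroup := soloInformed_pt_mem_bakerGroup _ _

/-- `ρ κ · t` lies in the Baker group for `t` in it. -/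
theorem soloInformed_ptHom_mul_mem_bakerGroup (k : algebraicClosure ℚ ℝ) {t : FormalPeriodRing}
    (ht : t ∈ soloInformedBakerGroup) : soloInformedPtHom k * t ∈ soloInformedBakerGroup :=
  soloInformed_pt_mul_mem_bakerGroup _ ht

/-- Every element of the Baker ring is an integer polynomial in finitely many elements of the
Baker group. [folklore] -/
theorem soloInformed_exists_aeval_of_mem_bakerRing {x : FormalPeriodRing}
    (hx : x ∈ soloInformedBakerRing) :
    ∃ (n : ℕ) (t : Fin n → FormalPeriodRing) (q : MvPolynomial (Fin n) ℤ),
      (∀ i, t i ∈ soloInformedBakerGroup) ∧ MvPolynomial.aeval t q = x := by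
  have h1 : soloInformedBakerRing ≤
      (Algebra.adjoin ℤ (soloInformedBakerGroup : Set FormalPeriodRing)).toSubring :=
    Subring.closure_le.2 Algebra.subset_adjoin
  have h2 : x ∈ Algebra.adjoin ℤ (soloInformedBakerGroup : Set FormalPeriodRing) :=
    Subalgebra.mem_toSubring.1 (h1 hx)
  rw [Algebra.adjoin_eq_range, AlgHom.mem_range] at h2
  obtain ⟨p, rfl⟩ := h2
  obtain ⟨n, f, -, q, rfl⟩ := MvPolynomial.exists_fin_rename p
  exact ⟨n, fun i => (f i : FormalPeriodRing), q, fun i => (f i).2,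
    by rw [MvPolynomial.aeval_rename]; rfl⟩

/-- **The period conjecture on the Baker ring, from algebraic independence of logarithms.**
Assuming `AlgIndepLogarithms`, an element of the Baker ring with value `0` is `0` in `P`.
[Waldschmidt 2000, Conj. 1.15 (hypothesis); Kontsevich–Zagier 2001, §1.2; this work] -/
theorem soloInformed_eq_zero_of_mem_bakerRing (hAIL : AlgIndepLogarithms) {x : FormalPeriodRing}
    (hx : x ∈ soloInformedBakerRing) (h0 : evalP x = 0) : x = 0 := by
  classical
  obtain ⟨n, t, q, ht, rfl⟩ := soloInformed_exists_aeval_of_mem_bakerRing hx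
  -- the values and a `K`-basis `b ∋ 1` of their span with `1`
  set v : Fin n → ℝ := fun i => evalP (t i) with hv
  have hvB : ∀ i, v i ∈ soloInformedBakerValues := fun i =>
    soloInformed_evalP_mem_bakerValues (ht i)
  set S : Set ℝ := insert 1 (Set.range v) with hS
  have hSfin : S.Finite := (Set.finite_range v).insert 1
  have h1li : LinearIndepOn (algebraicClosure ℚ ℝ) id ({1} : Set ℝ) :=
    LinearIndepOn.singleton one_ne_zero
  obtain ⟨b, hbS, h1b, hSb, hbli⟩ :=
    exists_linearIndepOn_id_extension h1li (Set.singleton_subset_iff.2 (Set.mem_insert _ _))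
  have h1mem : (1 : ℝ) ∈ b := h1b (Set.mem_singleton 1)
  set B : Set ℝ := b \ {1} with hB
  haveI : Fintype B := ((hSfin.subset hbS).subset fun y hy => hy.1).fintype
  -- the family `(1, e)` enumerating `b`
  set e : B → ℝ := fun l => (l : ℝ) with he
  set fam : Option B → ℝ := fun o => o.elim (1 : ℝ) e with hfam
  have hmemS : ∀ l : B, ∃ i, v i = e l := by
    intro l
    rcases hbS l.2.1 with hl1 | ⟨i, hi⟩
    · exact absurd hl1 l.2.2
    · exact ⟨i, hi⟩
  have hfam_range : Set.range fam = b := by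
    ext y
    constructor
    · rintro ⟨o, rfl⟩
      cases o with
      | none => exact h1mem
      | some l => exact l.2.1
    · intro hy
      by_cases hy1 : y = 1
      · exact ⟨none, hy1 ▸ rfl⟩
      · exact ⟨some ⟨y, hy, hy1⟩, rfl⟩
  have hfam_inj : Function.Injective fam := by
    intro o o' h
    cases o with
    | none =>
      cases o' with
      | none => rfl
      | some l' => exact absurd h.symm l'.2.2
    | some l =>
      cases o' with
      | none => exact absurd h l.2.2
      | some l' => exact congrArg some (Subtype.ext h)
  have hli : LinearIndependent (algebraicClosure ℚ ℝ) fam := by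
    let g : Option B → b := fun o => ⟨fam o, hfam_range ▸ Set.mem_range_self o⟩
    have hg : Function.Injective g := fun o o' h => hfam_inj (congrArg Subtype.val h)
    exact hbli.linearIndependent.comp g hg
  -- transcendence input (file 1): `e` is algebraically independent over `K`
  have heB : ∀ l : B, e l ∈ soloInformedBakerValues := by
    intro l
    obtain ⟨i, hi⟩ := hmemS l
    rw [← hi]
    exact hvB i
  have hAI := soloInformed_algebraicIndependent_of_algIndepLogarithms hAIL e heB hli
  -- coordinates of `v i` in the basis, and the lift to `P`
  have hvspan : ∀ i, v i ∈ Submodule.span (algebraicClosure ℚ ℝ) (Set.range fam) := by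
    intro i
    rw [hfam_range]
    exact hSb (Set.mem_insert_of_mem _ (Set.mem_range_self i))
  choose κ hκ using fun i => (Submodule.mem_span_range_iff_exists_fun _).1 (hvspan i)
  have hκ' : ∀ i, (κ i none : ℝ) + ∑ l, (κ i (some l) : ℝ) * e l = v i := by
    intro i
    have := hκ i
    rw [Fintype.sum_option] at this
    simpa [hfam, Algebra.smul_def] using this
  choose idx hidx using hmemS
  set u : B → FormalPeriodRing := fun l => t (idx l) with hu
  have hue : ∀ l, evalP (u l) = e l := fun l => hidx l
  have ht_eq : ∀ i, t i =
      soloInformedPtHom (κ i none) + ∑ l, soloInformedPtHom (κ i (some l)) * u l := by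
    intro i
    refine soloInformed_bakerGroup_eq_of_evalP_eq (ht i) (add_mem
      (soloInformed_ptHom_mem_bakerGroup _)
      (sum_mem fun l _ => soloInformed_ptHom_mul_mem_bakerGroup _ (ht _))) ?_
    rw [map_add, map_sum]
    simpa only [map_mul, soloInformed_evalP_ptHom, hue] using (hκ' i).symm
  -- one polynomial `P₁ ∈ K[Y]` computing `x` from `u` and `evalP x` from `e`
  set L : Fin n → MvPolynomial B (algebraicClosure ℚ ℝ) := fun i =>
    MvPolynomial.C (κ i none) + ∑ l, MvPolynomial.C (κ i (some l)) * MvPolynomial.X l with hL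
  set P₁ : MvPolynomial B (algebraicClosure ℚ ℝ) :=
    MvPolynomial.aeval L (MvPolynomial.map (Int.castRingHom (algebraicClosure ℚ ℝ)) q) with hP₁
  have hLe : ∀ i, MvPolynomial.aeval e (L i) = v i := by
    intro i
    simp only [hL, map_add, map_sum, map_mul, MvPolynomial.aeval_C, MvPolynomial.aeval_X]
    simpa [Algebra.smul_def] using hκ' i
  have hreal : MvPolynomial.aeval e P₁ = evalP (MvPolynomial.aeval t q) := by
    have hhom : (MvPolynomial.aeval e).toRingHom.comp ((MvPolynomial.aeval L).toRingHom.comp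
        (MvPolynomial.map (Int.castRingHom (algebraicClosure ℚ ℝ)))) =
        evalP.comp
          (MvPolynomial.aeval t : MvPolynomial (Fin n) ℤ →ₐ[ℤ] FormalPeriodRing).toRingHom := by
      refine MvPolynomial.ringHom_ext (fun r => by simp) (fun i => ?_)
      simp only [RingHom.comp_apply, AlgHom.toRingHom_eq_coe, AlgHom.coe_toRingHom,
        MvPolynomial.map_X, MvPolynomial.aeval_X]
      exact hLe i
    simpa [hP₁] using congrArg (fun f => f q) hhom
  have hP₁0 : P₁ = 0 := (algebraicIndependent_iff.1 hAI) _ (by rw [hreal, h0])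
  have hPside : MvPolynomial.eval₂Hom soloInformedPtHom u P₁ = MvPolynomial.aeval t q := by
    have hhom : (MvPolynomial.eval₂Hom soloInformedPtHom u).comp
        ((MvPolynomial.aeval L).toRingHom.comp
          (MvPolynomial.map (Int.castRingHom (algebraicClosure ℚ ℝ)))) =
        (MvPolynomial.aeval t : MvPolynomial (Fin n) ℤ →ₐ[ℤ] FormalPeriodRing).toRingHom := by
      refine MvPolynomial.ringHom_ext (fun r => by simp) (fun i => ?_)
      simp only [RingHom.comp_apply, AlgHom.toRingHom_eq_coe, AlgHom.coe_toRingHom,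
        MvPolynomial.map_X, MvPolynomial.aeval_X, hL, map_add, map_sum, map_mul,
        MvPolynomial.eval₂Hom_C, MvPolynomial.eval₂Hom_X']
      exact (ht_eq i).symm
    simpa [hP₁] using congrArg (fun f => f q) hhom
  rw [← hPside, hP₁0, map_zero]

/-- **`evalP` is injective on the Baker ring** (under `AlgIndepLogarithms`): the period conjecture
`KontsevichZagierPeriods ↔ Function.Injective evalP` holds for all pairs in the Baker ring.
[this work] -/
theorem soloInformed_injOn_evalP_bakerRing (hAIL : AlgIndepLogarithms) :
    Set.InjOn evalP (soloInformedBakerRing : Set FormalPeriodRing) := by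
  intro x hx y hy h
  have := soloInformed_eq_zero_of_mem_bakerRing hAIL (sub_mem hx hy) (by rw [map_sub, h, sub_self])
  exact sub_eq_zero.1 this

/-- Rational representations of dimension `≤ 1` (integrand `p/q`, `p, q ∈ ℚ[x]`, `q ≠ 0` on the
domain) have their class in the Baker ring. -/
theorem soloInformed_mem_bakerRing_of_isRational {n : ℕ} (hn : n ≤ 1) (r : IntegralRep n)
    (hr : r.IsRational) : toFormalPeriod (of r) ∈ soloInformedBakerRing :=
  soloInformed_bakerGroup_le_bakerRing
    (soloInformed_toFormalPeriod_mem_bakerGroup (soloInformed_of_mem_segSpan_of_isRational hn r hr))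

/-- `K`-rational representations of dimension `1` (real algebraic coefficients) have their class in
the Baker ring. -/
theorem soloInformed_mem_bakerRing_of_isKRationalOne (r : IntegralRep 1)
    (hr : SoloInformedIsKRationalOne r) : toFormalPeriod (of r) ∈ soloInformedBakerRing :=
  soloInformed_bakerGroup_le_bakerRing
    (soloInformed_toFormalPeriod_mem_bakerGroup (soloInformed_segSpan_of_isKRationalOne r hr))

/-- Every dimension-`0` representation has its class in the Baker ring. -/
theorem soloInformed_mem_bakerRing_of_dim_zero (r : IntegralRep 0) :
    toFormalPeriod (of r) ∈ soloInformedBakerRing :=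
  soloInformed_bakerGroup_le_bakerRing
    (soloInformed_toFormalPeriod_mem_bakerGroup (soloInformed_segSpan_of_dim_zero r))

/-- Products stay in the Baker ring: `⟦[σ × τ, f ⊗ g]⟧ = ⟦[σ, f]⟧ · ⟦[τ, g]⟧`. -/
theorem soloInformed_prod_mem_bakerRing {n m : ℕ} {r : IntegralRep n} {s : IntegralRep m}
    (hr : toFormalPeriod (of r) ∈ soloInformedBakerRing)
    (hs : toFormalPeriod (of s) ∈ soloInformedBakerRing) :
    toFormalPeriod (of (r.prod s)) ∈ soloInformedBakerRing := by
  rw [← toFormalPeriod_of_mul_of]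
  exact mul_mem hr hs

/-- **The period conjecture for formal combinations in the Baker ring** (under
`AlgIndepLogarithms`): equal values ⇒ the difference is a relation. [this work] -/
theorem soloInformed_sub_mem_relations_of_mem_bakerRing (hAIL : AlgIndepLogarithms)
    {c d : FormalRep} (hc : toFormalPeriod c ∈ soloInformedBakerRing)
    (hd : toFormalPeriod d ∈ soloInformedBakerRing) (h : eval c = eval d) :
    c - d ∈ relations :=
  toFormalPeriod_eq_iff.1 (soloInformed_injOn_evalP_bakerRing hAIL hc hd (by simpa using h))

/-- **Products of one-variable rational integrals** (under `AlgIndepLogarithms`): if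
`∫∫_{D₁×D₂} f₁(x) f₂(y) = ∫∫_{D₁'×D₂'} f₁'(x) f₂'(y)` for rational integrands over `ℚ` in dimension
`≤ 1`, the two product representations are KZ-equivalent (linked by the three moves) — a family of
genuinely two-dimensional instances of the conjecture, e.g. `(log 2)²`, `log 2 · log 3`.
[Kontsevich–Zagier 2001, §1.2; this work] -/
theorem soloInformed_equivalent_prod_of_isRational (hAIL : AlgIndepLogarithms)
    {n m n' m' : ℕ} (hn : n ≤ 1) (hm : m ≤ 1) (hn' : n' ≤ 1) (hm' : m' ≤ 1)
    {r : IntegralRep n} {s : IntegralRep m} {r' : IntegralRep n'} {s' : IntegralRep m'}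
    (hr : r.IsRational) (hs : s.IsRational) (hr' : r'.IsRational) (hs' : s'.IsRational)
    (h : (r.prod s).value = (r'.prod s').value) : Equivalent (r.prod s) (r'.prod s') :=
  soloInformed_sub_mem_relations_of_mem_bakerRing hAIL
    (soloInformed_prod_mem_bakerRing (soloInformed_mem_bakerRing_of_isRational hn r hr)
      (soloInformed_mem_bakerRing_of_isRational hm s hs))
    (soloInformed_prod_mem_bakerRing (soloInformed_mem_bakerRing_of_isRational hn' r' hr')
      (soloInformed_mem_bakerRing_of_isRational hm' s' hs'))
    (by simpa using h)

end Summit.KontsevichZagierPeriods.KontsevichZagierPeriods.Theorems
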